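import Mathlib
import Summits.Ventures.PercRepro2.TypedBEdgeTypeTwo
import Summits.Ventures.PercRepro2.TypedContract
import Summits.Ventures.PercRepro2.TypedVanishing

/-!
# The root edge at the mark `b`: the type-1 count is the sum of the deleted and the type-2 counts
(blind cell PercRepro2, night-3 g17, 2026-08-27; NIGHT3-CERT.md §26.8 — the `b`-twin of
TypedORootEdgeSplit)

With `f = {b, a₁}` pinned open the count vanishes (`typedCount_b_root_open`: `b = a₁` in every
copy, the typed root coincidence `typedCount_eq_zero_of_b_eq_a1`), so «type 2 = type 1 + pinned
open − deleted» at `f` (`typedCount_b_edge_type_two`, with any other typed edge `e` of type `1`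
and the other edges at `b` pinned closed) reads `N(τ[f := 1]) = N(τ[f := 0]) + N(τ[f := 2])`
(`typedCount_b_root_edge_split`); row 2′TRI at the `(1, 1)` instance follows from the `(1, 0)`
and `(1, 2)` instances (`typedCount_nonneg_b_root_of_two`).  Own work; standard axioms.
-/

namespace Summit.Ventures.PercRepro2

namespace CovForm

namespace TypedRed

open OneTyped Contract TypedVanish

section Main

open Classical

variable {V : Type*} {E : Type*} [Fintype E] [DecidableEq E] {R : Type*} [Field R]
  [LinearOrder R] [IsStrictOrderedRing R]

variable (ends : E → Sym2 V) (o a₁ a₂ a₃ b : V)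

/-- **A root edge at `b` pinned open kills the count**: `f = {b, a₁}` of type `3`. -/
theorem typedCount_b_root_open {f : E} (hf : ends f = s(b, a₁)) (F : Finset E) (hfF : f ∈ F)
    (z : Config E) (τ : E → ℕ) (hτ : τ f = 3) :
    typedCount F z τ (K3 ends o a₁ a₂ a₃ b : Config E → Config E → Config E → R) = 0 := by
  rw [typedCount_type_three F f hfF z τ hτ]
  have hf' : ends f = s(a₁, b) := by rw [hf, Sym2.eq_swap]
  rw [typedCount_contract_open ends o a₁ a₂ a₃ b hf' (F.erase f) (Finset.notMem_erase f F)
    (Function.update z f true) (by simp) τ]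
  rw [contractMap_of_mem (by simp : b ∈ ({a₁, b} : Finset V)),
    contractMap_of_mem (by simp : a₁ ∈ ({a₁, b} : Finset V)), typedCount_eq_zero_of_b_eq_a1]

/-- **The split at the root edge of `b`**: with `e` (of type `1`) the only other typed edge at `b`,
`N(τ[f := 1]) = N(τ[f := 0]) + N(τ[f := 2])`. -/
theorem typedCount_b_root_edge_split {e f : E} (hf : ends f = s(b, a₁)) (hef : e ≠ f)
    (hbo : b ≠ o) (hb1 : b ≠ a₁) (hb2 : b ≠ a₂) (hb3 : b ≠ a₃) (F : Finset E) (heF : e ∈ F)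
    (hfF : f ∈ F) (z : Config E) (τ : E → ℕ) (hτe : τ e = 1)
    (hcl : ∀ e', e' ≠ e → e' ≠ f → b ∈ ends e' → e' ∉ F ∧ z e' = false) :
    typedCount F z (Function.update τ f 1)
        (K3 ends o a₁ a₂ a₃ b : Config E → Config E → Config E → R) =
      typedCount F z (Function.update τ f 0) (K3 ends o a₁ a₂ a₃ b) +
        typedCount F z (Function.update τ f 2) (K3 ends o a₁ a₂ a₃ b) := by
  have hcl' : ∀ e', e' ≠ f → e' ≠ e → b ∈ ends e' → e' ∉ F ∧ z e' = false :=
    fun e' h1 h2 h3 => hcl e' h2 h1 h3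
  have h := typedCount_b_edge_type_two (R := R) ends o a₁ a₂ a₃ b (e := f) (f := e) (u := a₁) hf hb1
    hef.symm hbo hb1 hb2 hb3 F hfF heF z τ hτe hcl'
  rw [typedCount_b_root_open ends o a₁ a₂ a₃ b hf F hfF z _ (Function.update_self _ _ _)] at h
  linarith

/-- **Row 2′TRI at the `(1, 1)` instance of a root edge at `b` from the `(1, 0)` and `(1, 2)`
instances.** -/
theorem typedCount_nonneg_b_root_of_two {e f : E} (hf : ends f = s(b, a₁)) (hef : e ≠ f)
    (hbo : b ≠ o) (hb1 : b ≠ a₁) (hb2 : b ≠ a₂) (hb3 : b ≠ a₃) (F : Finset E) (heF : e ∈ F)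
    (hfF : f ∈ F) (z : Config E) (τ : E → ℕ) (hτe : τ e = 1)
    (hcl : ∀ e', e' ≠ e → e' ≠ f → b ∈ ends e' → e' ∉ F ∧ z e' = false)
    (h0 : 0 ≤ typedCount F z (Function.update τ f 0)
      (K3 ends o a₁ a₂ a₃ b : Config E → Config E → Config E → R))
    (h2 : 0 ≤ typedCount F z (Function.update τ f 2)
      (K3 ends o a₁ a₂ a₃ b : Config E → Config E → Config E → R)) :
    0 ≤ typedCount F z (Function.update τ f 1)
      (K3 ends o a₁ a₂ a₃ b : Config E → Config E → Config E → R) := by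
  rw [typedCount_b_root_edge_split ends o a₁ a₂ a₃ b hf hef hbo hb1 hb2 hb3 F heF hfF z τ hτe hcl]
  exact add_nonneg h0 h2

end Main

end TypedRed

end CovForm

end Summit.Ventures.PercRepro2
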